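import Literature.AlgebraicGeometry.Frobenioids.PadicFrobenioidPairIsoAlgClosure
import Literature.AlgebraicGeometry.Frobenioids.PadicKummerRelCosetGaloisConj
import Literature.AnabelianGeometry.AbsoluteAnabelian.AbsAnabUnitsTransportUnique
import Literature.AnabelianGeometry.AbsoluteAnabelian.AbsAnabUnitsTransportHolds
import Literature.NumberTheory.GaloisRepresentations.LocalFieldFiniteExtension
import Literature.NumberTheory.GaloisRepresentations.LocalFieldPadicProofs
import HarnessLib

/-!
# Frobenioids II, Thm. 2.4 (ii): RIGIDITY of the pair `G₁ ⥲ G₂`, `K̄₁^× ⥲ K̄₂^×`, and its [AbsAnab] chart reading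

Mochizuki, *The geometry of Frobenioids II*, Kyushu J. Math. **62** (2008) 401–460, §2, proof of Thm. 2.4 (ii), p. 20 l.−5 –
p. 21 l. 6 [cite: MochizukiFrdII2008, Thm 2.4 (ii) p.21]: "`Ψ` induces a pair of compatible isomorphisms `G₁ ⥲ G₂`; `K̄₁^× ⥲ K̄₂^×`
[well-defined up to composition with an element of `G₂`] … we may apply [the theory of [AbsAnab], Prop. 1.2.1]".
PROOF-ONLY companion (cell abc-iut, `plan/L1/SUBDAG-FrdII-Thm24.md` row W12-L17, node FrdII:Thm2.4(ii); seat abc-iut-w5-d229),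
sequel to `PadicFrobenioidPairIsoAlgClosure` (the pair on the literal `ℚ̄_{pᵢ}^×`).  Theorems only, no definitions:
* §1 `fbarUnits_mulEquiv_eq_self_or_eq_inv` — an automorphism of `ℚ̄_p^×` commuting with `Im(Π → G_{ℚ_p})` (open) is `id` or
  `u ↦ u⁻¹` (the tree's [AbsTopIII] Prop. 3.3 (ii) rigidity `MLFClosure.nonZeroDivisors_mulEquiv_eq_self_or_eq_inv` at the MLF
  `K = ℚ̄_p^{Im Π}` of Def. 2.2, abc-iut-L1-t7's `PadicFrd.RelGal.baseFld`);
* §2 `fbarUnitsEquiv_eq_or_eq_inv_of_equivariant` — two `K̄₁^× ⥲ K̄₂^×` compatible with the SAME `Π₁ ↠ Π₂` coincide or differ by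
  inversion: the `K̄^×`-component of the printed pair carries ONE bit beyond `G₁ ⥲ G₂`;
* §3 `exists_isAlphaEquivariant_of_compatible` — the chart reading: `α := galConjBase₂⁻¹ ∘ ψ ∘ galConjBase₁ : Gal(K̄₁/K₁) ≃ₜ*
  Gal(K̄₂/K₂)` and `ψ̄♮ := ι₂⁻¹ ∘ ψ̄ ∘ ι₁` (`ιᵢ = closureEquiv`) with `Prop121vii.IsAlphaEquivariant α ψ̄♮` ([AbsAnab] 1.2.1 (vi));
* §4 `preservesAbsUnits_of_isAlphaEquivariant` — for MLFs, EVERY `α`-equivariant `K̄₁^× ⥲ K̄₂^×` preserves `𝒪^×` and is THE units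
  transport of row L02 (`unitsTransport_holds`, abc-iut-L4-d3) up to inversion (`IsAlphaEquivariant.eq_or_eq_inv`, abc-iut-L6-t13);
* §5 `exists_pairIso_absAnabChart` — assembled for a GENERAL equivalence `Ψ` of fieldwise saturated `p`-adic Frobenioids over the
  genuine bases: (`φ`, `ψ`, `ψ̄`, `α`, `ψ̄♮`) with `ψ̄♮` `α`-equivariant, unit-preserving, `= ψ₀^{±1}` for THE transport `ψ₀`, and the
  `K̄^×`-rigidity — i.e. the (R2) input (`IsAlphaEquivariant ∧ PreservesAbsUnits ∧ PreservesUniformizers`) of W12's Thm. 2.4 (ii)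
  closer (abc-iut-w5-d201) for the `Ψ`-induced `ψ̄`, up to the single orientation bit that [FrdI] Cor. 4.11 supplies in print.
Nothing here bears on [IUTchIII] Cor. 3.12.
-/

noncomputable section

namespace Literature.AlgebraicGeometry.Frobenioids

open Topology Filter Field IntermediateField
open Literature.AnabelianGeometry.SemiGraphs QuasiTemperoid
open Literature.NumberTheory.GaloisRepresentations
open Literature.AnabelianGeometry.AbsoluteAnabelian
open scoped nonZeroDivisors

namespace BaseGaloisSystem

/-! ### §1 An automorphism of `ℚ̄_p^×` commuting with `Im(Π → G_{ℚ_p})` is the identity or the inversion -/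

section Rigidity

variable {p : ℕ} [Fact p.Prime] {P : Type} [Group P] [TopologicalSpace P]
  (φ₀ : P →* GalFbar ℚ_[p]) (hφ₀ : IsOpenHom φ₀)

include hφ₀ in
/-- **Rigidity of `ℚ̄_p^×` under an open image.**  For an open homomorphism `φ₀ : Π → G_{ℚ_p}`, a multiplicative
automorphism `γ` of `ℚ̄_p^×` commuting with every `φ₀(π)` is the identity or the inversion `u ↦ u⁻¹`: `G = Im(Π)` is
`Gal(ℚ̄_p/K)` for the finite extension `K = ℚ̄_p^G` of `ℚ_p` (`PadicFrd.RelGal.baseFld`, Def. 2.2 p. 17), `ℚ̄_p` is an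
algebraic closure of `K`, and the tree's rigidity theorem `MLFClosure.nonZeroDivisors_mulEquiv_eq_self_or_eq_inv`
([AbsTopIII] Prop. 3.3 (ii), "fibers of cardinality two") applies to the MLF `K`. [cite: MochizukiFrdII2008, Thm 2.4 (ii) p.21] -/
theorem fbarUnits_mulEquiv_eq_self_or_eq_inv (γ : (Fbar ℚ_[p])ˣ ≃* (Fbar ℚ_[p])ˣ)
    (hγ : ∀ (π : P) (u : (Fbar ℚ_[p])ˣ),
      γ (Units.map ((φ₀ π : GalFbar ℚ_[p]) : Fbar ℚ_[p] →* Fbar ℚ_[p]) u) =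
        Units.map ((φ₀ π : GalFbar ℚ_[p]) : Fbar ℚ_[p] →* Fbar ℚ_[p]) (γ u)) :
    (∀ u, γ u = u) ∨ ∀ u, γ u = u⁻¹ := by
  -- the MLF `K = ℚ̄_p^{Im φ₀}` with its algebraic closure `ℚ̄_p`
  haveI : IsNonarchimedeanLocalField ℚ_[p] := Padic.isNonarchimedeanLocalField_holds p
  haveI := PadicFrd.RelGal.finiteDimensional_baseFld p φ₀ hφ₀
  letI := FiniteExtension.valuativeRel ℚ_[p] (PadicFrd.RelGal.baseFld p φ₀ hφ₀)
  letI := FiniteExtension.topologicalSpace ℚ_[p] (PadicFrd.RelGal.baseFld p φ₀ hφ₀)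
  haveI : IsNonarchimedeanLocalField (PadicFrd.RelGal.baseFld p φ₀ hφ₀) :=
    FiniteExtension.isNonarchimedeanLocalField ℚ_[p] (PadicFrd.RelGal.baseFld p φ₀ hφ₀)
  haveI : CharZero (PadicFrd.RelGal.baseFld p φ₀ hφ₀) :=
    charZero_of_injective_algebraMap (algebraMap ℚ_[p] (PadicFrd.RelGal.baseFld p φ₀ hφ₀)).injective
  haveI := PadicFrd.RelGal.isAlgClosure_baseFld p φ₀ hφ₀
  let C : MLFClosure.{0} := { k := PadicFrd.RelGal.baseFld p φ₀ hφ₀, K := Fbar ℚ_[p] }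
  -- move `γ` to the non-zero-divisors
  let e : ↥(nonZeroDivisors (Fbar ℚ_[p])) ≃* (Fbar ℚ_[p])ˣ := nonZeroDivisorsEquivUnits
  let γ' : ↥(nonZeroDivisors (Fbar ℚ_[p])) ≃* ↥(nonZeroDivisors (Fbar ℚ_[p])) := (e.trans γ).trans e.symm
  have hγ'val : ∀ z : ↥(nonZeroDivisors (Fbar ℚ_[p])),
      ((γ' z : ↥(nonZeroDivisors (Fbar ℚ_[p]))) : Fbar ℚ_[p]) = ((γ (e z) : (Fbar ℚ_[p])ˣ) : Fbar ℚ_[p]) :=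
    fun z => rfl
  have hγ' : ∀ (σ : C.K ≃ₐ[C.k] C.K) (x : ↥(nonZeroDivisors C.K)),
      (γ' ⟨σ • (x : C.K), smul_mem_nonZeroDivisors σ x.2⟩ : C.K) = σ • (γ' x : C.K) := by
    intro σ x
    obtain ⟨π, hπ⟩ := PadicFrd.RelGal.exists_map_eq_restrictScalars p φ₀ hφ₀ σ
    have hx : e ⟨σ • (x : C.K), smul_mem_nonZeroDivisors σ x.2⟩ =
        Units.map ((φ₀ π : GalFbar ℚ_[p]) : Fbar ℚ_[p] →* Fbar ℚ_[p]) (e x) := by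
      ext
      rw [Units.coe_map, MonoidHom.coe_coe, hπ]
      rfl
    rw [hγ'val, hγ'val, hx, hγ, Units.coe_map, MonoidHom.coe_coe, hπ]
    rfl
  rcases C.nonZeroDivisors_mulEquiv_eq_self_or_eq_inv γ' hγ' with h | h
  · left
    intro u
    have h2 := congrArg Subtype.val (h (e.symm u))
    rw [hγ'val, MulEquiv.apply_symm_apply] at h2
    exact Units.ext h2
  · right
    intro u
    have h2 := h (e.symm u)
    rw [hγ'val, MulEquiv.apply_symm_apply] at h2
    exact Units.ext (by rw [h2, Units.val_inv_eq_inv_val]; rfl)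

end Rigidity

/-! ### §2 The `K̄₁^× ⥲ K̄₂^×` compatible with a given `G₁ ⥲ G₂` is unique up to inversion -/

section Unique

variable {p₁ p₂ : ℕ} [Fact p₁.Prime] [Fact p₂.Prime]
  {G : Type} [Group G] {G₂ : Type} [Group G₂] [TopologicalSpace G₂]
  (φ₁ : G →* GalFbar ℚ_[p₁]) (φ₂ : G₂ →* GalFbar ℚ_[p₂]) (hφ₂ : IsOpenHom φ₂)

include hφ₂ in
/-- **[FrdII] Thm. 2.4 (ii): the `K̄^×`-component of the compatible pair is RIGID.**  Over the genuine bases, two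
isomorphisms `ψ̄, ψ̄' : ℚ̄_{p₁}^× ⥲ ℚ̄_{p₂}^×` that are both compatible with the SAME `Π₁ → Π₂` (`φ` with `φ₂ ∘ φ` of open
image, e.g. `φ` surjective and `φ₂` open) — `ψ̄(φ₁(g)·a) = φ₂(φ g)·ψ̄(a)` and likewise for `ψ̄'` — COINCIDE or differ by the
inversion of `ℚ̄_{p₂}^×`: `ψ̄' ∘ ψ̄⁻¹` commutes with `Im φ₂` (`fbarUnits_mulEquiv_eq_self_or_eq_inv`).  So the printed pair
"`G₁ ⥲ G₂`; `K̄₁^× ⥲ K̄₂^×`" carries, beyond `G₁ ⥲ G₂`, exactly one bit on the `K̄^×`-side (the author's "well-defined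
up to composition with an element of `G₂`" being absorbed by the compatibility with a FIXED descent).
[cite: MochizukiFrdII2008, Thm 2.4 (ii) p.21] -/
theorem fbarUnitsEquiv_eq_or_eq_inv_of_equivariant {φ : G → G₂} (hφ : Function.Surjective φ)
    (ψbar ψbar' : (Fbar ℚ_[p₁])ˣ ≃* (Fbar ℚ_[p₂])ˣ)
    (h : ∀ (g : G) (u : (Fbar ℚ_[p₁])ˣ),
      ψbar (Units.map ((φ₁ g : GalFbar ℚ_[p₁]) : Fbar ℚ_[p₁] →* Fbar ℚ_[p₁]) u) =
        Units.map ((φ₂ (φ g) : GalFbar ℚ_[p₂]) : Fbar ℚ_[p₂] →* Fbar ℚ_[p₂]) (ψbar u))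
    (h' : ∀ (g : G) (u : (Fbar ℚ_[p₁])ˣ),
      ψbar' (Units.map ((φ₁ g : GalFbar ℚ_[p₁]) : Fbar ℚ_[p₁] →* Fbar ℚ_[p₁]) u) =
        Units.map ((φ₂ (φ g) : GalFbar ℚ_[p₂]) : Fbar ℚ_[p₂] →* Fbar ℚ_[p₂]) (ψbar' u)) :
    ψbar' = ψbar ∨ ∀ u, ψbar' u = (ψbar u)⁻¹ := by
  let γ : (Fbar ℚ_[p₂])ˣ ≃* (Fbar ℚ_[p₂])ˣ := ψbar.symm.trans ψbar'
  have hγ : ∀ (π : G₂) (v : (Fbar ℚ_[p₂])ˣ),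
      γ (Units.map ((φ₂ π : GalFbar ℚ_[p₂]) : Fbar ℚ_[p₂] →* Fbar ℚ_[p₂]) v) =
        Units.map ((φ₂ π : GalFbar ℚ_[p₂]) : Fbar ℚ_[p₂] →* Fbar ℚ_[p₂]) (γ v) := by
    intro π v
    obtain ⟨g, rfl⟩ := hφ π
    obtain ⟨u, rfl⟩ := ψbar.surjective v
    change ψbar' (ψbar.symm _) = Units.map _ (ψbar' (ψbar.symm (ψbar u)))
    rw [← h g u, MulEquiv.symm_apply_apply, MulEquiv.symm_apply_apply, h' g u]
  rcases fbarUnits_mulEquiv_eq_self_or_eq_inv φ₂ hφ₂ γ hγ with hid | hinv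
  · left
    apply MulEquiv.ext
    intro u
    have h1 := hid (ψbar u)
    change ψbar' (ψbar.symm (ψbar u)) = ψbar u at h1
    rwa [MulEquiv.symm_apply_apply] at h1
  · right
    intro u
    have h1 := hinv (ψbar u)
    change ψbar' (ψbar.symm (ψbar u)) = (ψbar u)⁻¹ at h1
    rwa [MulEquiv.symm_apply_apply] at h1

end Unique

/-! ### §3 The pair in the [AbsAnab] chart of the base fields: `α : G_{K₁} ⥲ G_{K₂}`, `ψ̄♮ : K̄₁^× ⥲ K̄₂^×`, `α`-equivariant -/

section Chart

variable {p₁ p₂ : ℕ} [Fact p₁.Prime] [Fact p₂.Prime]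
  {G : Type} [Group G] [TopologicalSpace G] {G₂ : Type} [Group G₂] [TopologicalSpace G₂]
  (φ₁ : G →* GalFbar ℚ_[p₁]) (hφ₁ : IsOpenHom φ₁) (φ₂ : G₂ →* GalFbar ℚ_[p₂]) (hφ₂ : IsOpenHom φ₂)

/-- `Im(Π → G_{ℚ_p}) = Gal(ℚ̄_p/K)` for `K = ℚ̄_p^{Im Π}` (`PadicFrd.RelGal.mem_fixingSubgroup_baseFld_iff`), as an
equality of subgroups of `G_{ℚ_p}`. [cite: MochizukiFrdII2008, Def 2.2 p.17] -/
theorem range_eq_fixingSubgroup_baseFld {p : ℕ} [Fact p.Prime] {P : Type} [Group P] [TopologicalSpace P]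
    (φ₀ : P →* GalFbar ℚ_[p]) (hφ₀ : IsOpenHom φ₀) :
    φ₀.range = (PadicFrd.RelGal.baseFld p φ₀ hφ₀).fixingSubgroup := by
  ext g
  rw [MonoidHom.mem_range, PadicFrd.RelGal.mem_fixingSubgroup_baseFld_iff]

/-- **Transport to the [AbsAnab] chart.**  Let `Kᵢ = ℚ̄_{pᵢ}^{Gᵢ}` (`Gᵢ = Im φᵢ`; `PadicFrd.RelGal.baseFld`) with the
identifications `ιᵢ : K̄ᵢ = AlgebraicClosure Kᵢ ≅ ℚ̄_{pᵢ}` over `Kᵢ` (`closureEquiv`) and `Gal(K̄ᵢ/Kᵢ) ≅ Gal(ℚ̄_{pᵢ}/Kᵢ) = Gᵢ`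
(`galConjBase`, abc-iut-L1-t7).  A pair (`ψ : G₁ ≃ₜ* G₂`, `ψ̄ : ℚ̄_{p₁}^× ≃* ℚ̄_{p₂}^×`) with `ψ̄(σ·a) = ψ(σ)·ψ̄(a)` induces
`α : Gal(K̄₁/K₁) ≃ₜ* Gal(K̄₂/K₂)` — `galConjBase₂⁻¹ ∘ ψ ∘ galConjBase₁` — and `ψ̄♮ : K̄₁^× ≃* K̄₂^×` — `ι₂⁻¹ ∘ ψ̄ ∘ ι₁` — with
`ψ̄♮` `α`-EQUIVARIANT in the sense of `Prop121vii.IsAlphaEquivariant` ([AbsAnab] Prop. 1.2.1 (vi) "Galois-equivariant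
with respect to `α`"). [cite: MochizukiFrdII2008, Thm 2.4 (ii) p.21] -/
theorem exists_isAlphaEquivariant_of_compatible (ψ : φ₁.range ≃ₜ* φ₂.range)
    (ψbar : (Fbar ℚ_[p₁])ˣ ≃* (Fbar ℚ_[p₂])ˣ)
    (h : ∀ (σ : φ₁.range) (u : (Fbar ℚ_[p₁])ˣ),
      ψbar (Units.map ((σ : GalFbar ℚ_[p₁]) : Fbar ℚ_[p₁] →* Fbar ℚ_[p₁]) u) =
        Units.map (((ψ σ : φ₂.range) : GalFbar ℚ_[p₂]) : Fbar ℚ_[p₂] →* Fbar ℚ_[p₂]) (ψbar u)) :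
    ∃ (α : absoluteGaloisGroup (PadicFrd.RelGal.baseFld p₁ φ₁ hφ₁) ≃ₜ*
        absoluteGaloisGroup (PadicFrd.RelGal.baseFld p₂ φ₂ hφ₂))
      (ψn : (AlgebraicClosure (PadicFrd.RelGal.baseFld p₁ φ₁ hφ₁))ˣ ≃*
        (AlgebraicClosure (PadicFrd.RelGal.baseFld p₂ φ₂ hφ₂))ˣ),
      (∀ τ : absoluteGaloisGroup (PadicFrd.RelGal.baseFld p₁ φ₁ hφ₁),
        ((PadicFrd.RelGal.galConjBase p₂ φ₂ hφ₂ (α τ) : ↥(PadicFrd.RelGal.baseFld p₂ φ₂ hφ₂).fixingSubgroup) :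
            GalFbar ℚ_[p₂]) =
          (ψ ⟨(PadicFrd.RelGal.galConjBase p₁ φ₁ hφ₁ τ : ↥(PadicFrd.RelGal.baseFld p₁ φ₁ hφ₁).fixingSubgroup),
            MonoidHom.mem_range.mpr ((PadicFrd.RelGal.mem_fixingSubgroup_baseFld_iff p₁ φ₁ hφ₁ _).mp
              (PadicFrd.RelGal.galConjBase p₁ φ₁ hφ₁ τ).2)⟩ : GalFbar ℚ_[p₂])) ∧
      (∀ y : (AlgebraicClosure (PadicFrd.RelGal.baseFld p₁ φ₁ hφ₁))ˣ,
        ((ψn y : (AlgebraicClosure (PadicFrd.RelGal.baseFld p₂ φ₂ hφ₂))ˣ) :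
            AlgebraicClosure (PadicFrd.RelGal.baseFld p₂ φ₂ hφ₂)) =
          (PadicFrd.RelGal.closureEquiv p₂ φ₂ hφ₂).symm
            ((ψbar (Units.map ((PadicFrd.RelGal.closureEquiv p₁ φ₁ hφ₁ :
              AlgebraicClosure (PadicFrd.RelGal.baseFld p₁ φ₁ hφ₁) ≃ₐ[PadicFrd.RelGal.baseFld p₁ φ₁ hφ₁] Fbar ℚ_[p₁]) :
                AlgebraicClosure (PadicFrd.RelGal.baseFld p₁ φ₁ hφ₁) →* Fbar ℚ_[p₁]) y) : (Fbar ℚ_[p₂])ˣ) :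
              Fbar ℚ_[p₂])) ∧
      Prop121vii.IsAlphaEquivariant α ψn := by
  -- the casts `Im φᵢ = Gal(ℚ̄/Kᵢ)` as topological group isomorphisms (identity on elements)
  have hr₁ := range_eq_fixingSubgroup_baseFld φ₁ hφ₁
  have hr₂ := range_eq_fixingSubgroup_baseFld φ₂ hφ₂
  let c₁ : ↥φ₁.range ≃ₜ* ↥(PadicFrd.RelGal.baseFld p₁ φ₁ hφ₁).fixingSubgroup :=
    { MulEquiv.subgroupCongr hr₁ with
      continuous_toFun := continuous_induced_rng.2 continuous_subtype_val
      continuous_invFun := continuous_induced_rng.2 continuous_subtype_val }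
  let c₂ : ↥φ₂.range ≃ₜ* ↥(PadicFrd.RelGal.baseFld p₂ φ₂ hφ₂).fixingSubgroup :=
    { MulEquiv.subgroupCongr hr₂ with
      continuous_toFun := continuous_induced_rng.2 continuous_subtype_val
      continuous_invFun := continuous_induced_rng.2 continuous_subtype_val }
  let ι₁ := PadicFrd.RelGal.closureEquiv p₁ φ₁ hφ₁
  let ι₂ := PadicFrd.RelGal.closureEquiv p₂ φ₂ hφ₂
  let α : absoluteGaloisGroup (PadicFrd.RelGal.baseFld p₁ φ₁ hφ₁) ≃ₜ*
      absoluteGaloisGroup (PadicFrd.RelGal.baseFld p₂ φ₂ hφ₂) :=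
    ((PadicFrd.RelGal.galConjBase p₁ φ₁ hφ₁).trans c₁.symm).trans
      (ψ.trans (c₂.trans (PadicFrd.RelGal.galConjBase p₂ φ₂ hφ₂).symm))
  let ψn : (AlgebraicClosure (PadicFrd.RelGal.baseFld p₁ φ₁ hφ₁))ˣ ≃*
      (AlgebraicClosure (PadicFrd.RelGal.baseFld p₂ φ₂ hφ₂))ˣ :=
    ((Units.mapEquiv (ι₁ : AlgebraicClosure (PadicFrd.RelGal.baseFld p₁ φ₁ hφ₁) ≃* Fbar ℚ_[p₁])).trans ψbar).trans
      (Units.mapEquiv (ι₂.symm : Fbar ℚ_[p₂] ≃* AlgebraicClosure (PadicFrd.RelGal.baseFld p₂ φ₂ hφ₂)))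
  -- `α` through the charts is `ψ`
  have hα : ∀ τ, PadicFrd.RelGal.galConjBase p₂ φ₂ hφ₂ (α τ) =
      c₂ (ψ (c₁.symm (PadicFrd.RelGal.galConjBase p₁ φ₁ hφ₁ τ))) := fun τ => by
    change PadicFrd.RelGal.galConjBase p₂ φ₂ hφ₂ ((PadicFrd.RelGal.galConjBase p₂ φ₂ hφ₂).symm _) = _
    rw [ContinuousMulEquiv.apply_symm_apply]
    rfl
  have hαval : ∀ τ, ((PadicFrd.RelGal.galConjBase p₂ φ₂ hφ₂ (α τ) :
      ↥(PadicFrd.RelGal.baseFld p₂ φ₂ hφ₂).fixingSubgroup) : GalFbar ℚ_[p₂]) =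
        (ψ (c₁.symm (PadicFrd.RelGal.galConjBase p₁ φ₁ hφ₁ τ)) : GalFbar ℚ_[p₂]) := fun τ => by
    rw [hα]; rfl
  have hc₁ : ∀ τ, c₁.symm (PadicFrd.RelGal.galConjBase p₁ φ₁ hφ₁ τ) =
      ⟨(PadicFrd.RelGal.galConjBase p₁ φ₁ hφ₁ τ : ↥(PadicFrd.RelGal.baseFld p₁ φ₁ hφ₁).fixingSubgroup),
        MonoidHom.mem_range.mpr ((PadicFrd.RelGal.mem_fixingSubgroup_baseFld_iff p₁ φ₁ hφ₁ _).mp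
          (PadicFrd.RelGal.galConjBase p₁ φ₁ hφ₁ τ).2)⟩ := fun τ => Subtype.ext rfl
  refine ⟨α, ψn, fun τ => by rw [hαval, hc₁], fun y => rfl, fun τ y => ?_⟩
  -- `α`-equivariance: both sides are `ι₂⁻¹ (ψ(σ) · ψ̄(ι₁ y))`, `σ = galConjBase₁ τ`
  have hστ : α τ = (PadicFrd.RelGal.galConjBase p₂ φ₂ hφ₂).symm
      (c₂ (ψ (c₁.symm (PadicFrd.RelGal.galConjBase p₁ φ₁ hφ₁ τ)))) := rfl
  have hL : Units.map ((ι₁ : AlgebraicClosure (PadicFrd.RelGal.baseFld p₁ φ₁ hφ₁) ≃ₐ[PadicFrd.RelGal.baseFld p₁ φ₁ hφ₁]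
      Fbar ℚ_[p₁]) : AlgebraicClosure (PadicFrd.RelGal.baseFld p₁ φ₁ hφ₁) →* Fbar ℚ_[p₁]) (τ • y) =
        Units.map (((c₁.symm (PadicFrd.RelGal.galConjBase p₁ φ₁ hφ₁ τ) : ↥φ₁.range) : GalFbar ℚ_[p₁]) :
          Fbar ℚ_[p₁] →* Fbar ℚ_[p₁])
          (Units.map ((ι₁ : AlgebraicClosure (PadicFrd.RelGal.baseFld p₁ φ₁ hφ₁) ≃ₐ[PadicFrd.RelGal.baseFld p₁ φ₁ hφ₁]
            Fbar ℚ_[p₁]) : AlgebraicClosure (PadicFrd.RelGal.baseFld p₁ φ₁ hφ₁) →* Fbar ℚ_[p₁]) y) := by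
    apply Units.ext
    simp only [Units.coe_map, MonoidHom.coe_coe, Units.coe_smul]
    change ι₁ (τ • (y : AlgebraicClosure (PadicFrd.RelGal.baseFld p₁ φ₁ hφ₁))) =
      ((PadicFrd.RelGal.galConjBase p₁ φ₁ hφ₁ τ : ↥(PadicFrd.RelGal.baseFld p₁ φ₁ hφ₁).fixingSubgroup) :
        GalFbar ℚ_[p₁]) (ι₁ (y : AlgebraicClosure (PadicFrd.RelGal.baseFld p₁ φ₁ hφ₁)))
    rw [PadicFrd.RelGal.coe_galConjBase_apply]
    exact congrArg (fun z => ι₁ (τ • z)) (ι₁.symm_apply_apply (y : AlgebraicClosure _)).symm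
  have hmid := h (c₁.symm (PadicFrd.RelGal.galConjBase p₁ φ₁ hφ₁ τ))
    (Units.map ((ι₁ : AlgebraicClosure (PadicFrd.RelGal.baseFld p₁ φ₁ hφ₁) ≃ₐ[PadicFrd.RelGal.baseFld p₁ φ₁ hφ₁]
      Fbar ℚ_[p₁]) : AlgebraicClosure (PadicFrd.RelGal.baseFld p₁ φ₁ hφ₁) →* Fbar ℚ_[p₁]) y)
  apply Units.ext
  have lhs : ∀ z : (AlgebraicClosure (PadicFrd.RelGal.baseFld p₁ φ₁ hφ₁))ˣ,
      ((ψn z : (AlgebraicClosure (PadicFrd.RelGal.baseFld p₂ φ₂ hφ₂))ˣ) : AlgebraicClosure _) =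
        ι₂.symm ((ψbar (Units.map ((ι₁ : AlgebraicClosure (PadicFrd.RelGal.baseFld p₁ φ₁ hφ₁)
          ≃ₐ[PadicFrd.RelGal.baseFld p₁ φ₁ hφ₁] Fbar ℚ_[p₁]) : AlgebraicClosure (PadicFrd.RelGal.baseFld p₁ φ₁ hφ₁) →*
            Fbar ℚ_[p₁]) z) : (Fbar ℚ_[p₂])ˣ) : Fbar ℚ_[p₂]) := fun z => rfl
  rw [lhs, hL, hmid, Units.coe_map, MonoidHom.coe_coe, Units.coe_smul, hστ,
    PadicFrd.RelGal.galConjBase_symm_apply_apply, lhs, AlgEquiv.apply_symm_apply]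
  rfl

end Chart

/-! ### §4 Every `α`-equivariant `K̄₁^× ⥲ K̄₂^×` preserves `𝒪^×` and is THE units transport up to inversion -/

section Units

variable {K₁ K₂ : Type} [Field K₁] [ValuativeRel K₁] [TopologicalSpace K₁] [IsNonarchimedeanLocalField K₁]
  [CharZero K₁] [Field K₂] [ValuativeRel K₂] [TopologicalSpace K₂] [IsNonarchimedeanLocalField K₂] [CharZero K₂]

/-- **Rigidity ⇒ units.**  For MLFs `K₁`, `K₂` and `α : G_{K₁} ≃ₜ* G_{K₂}`, EVERY `α`-equivariant
`ψ̄ : K̄₁^× ⥲ K̄₂^×` coincides with THE units transport of [AbsAnab] Prop. 1.2.1 (vi)/(vii) (row L02: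
`Prop121vii.unitsTransport_holds`, abc-iut-L4-d3; unique by `unitsTransport_unique`, abc-iut-L6-t13) or with its
pointwise inverse (`IsAlphaEquivariant.eq_or_eq_inv`); in particular `ψ̄` maps `𝒪^×_{K̄₁}` onto `𝒪^×_{K̄₂}`
(`PreservesAbsUnits`, a condition symmetric under inversion) — with NO hypothesis on `ψ̄` beyond equivariance.
[cite: MochizukiAbsAnab2004, Prop 1.2.1 (vi) p.10] -/
theorem preservesAbsUnits_of_isAlphaEquivariant {α : absoluteGaloisGroup K₁ ≃ₜ* absoluteGaloisGroup K₂}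
    {ψ : (AlgebraicClosure K₁)ˣ ≃* (AlgebraicClosure K₂)ˣ} (hψ : Prop121vii.IsAlphaEquivariant α ψ) :
    Prop121vii.PreservesAbsUnits ψ ∧
      ∃ ψ₀ : (AlgebraicClosure K₁)ˣ ≃* (AlgebraicClosure K₂)ˣ,
        (Prop121vii.IsAlphaEquivariant α ψ₀ ∧ Prop121vii.PreservesAbsUnits ψ₀ ∧ Prop121vii.PreservesUniformizers ψ₀) ∧
        (ψ = ψ₀ ∨ ∀ x, ψ x = (ψ₀ x)⁻¹) := by
  obtain ⟨ψ₀, hψ₀, hu₀, hπ₀⟩ := Prop121vii.unitsTransport_holds K₁ K₂ α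
  have halt := hψ₀.eq_or_eq_inv hψ
  refine ⟨?_, ψ₀, ⟨hψ₀, hu₀, hπ₀⟩, halt⟩
  rcases halt with h | h
  · rw [h]; exact hu₀
  · intro x
    rw [h x, inv_inv, (hu₀ x)]
    exact And.comm

end Units

/-! ### §5 [FrdII] Thm. 2.4 (ii) for a general `Ψ`: the pair in the [AbsAnab] chart — equivariant, unit-preserving,
THE units transport up to inversion -/

section Assembled

open CategoryTheory

variable {p₁ p₂ : ℕ} [Fact p₁.Prime] [Fact p₂.Prime]
  {G : Type} [Group G] [TopologicalSpace G] [IsTopologicalGroup G] (hG : IsTempered G)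
  {G₂ : Type} [Group G₂] [TopologicalSpace G₂] [IsTopologicalGroup G₂] (hG₂ : IsTempered G₂)
  (φ₁ : G →* GalFbar ℚ_[p₁]) (hφ₁ : IsOpenHom φ₁) (φ₂ : G₂ →* GalFbar ℚ_[p₂]) (hφ₂ : IsOpenHom φ₂)
  (N : ℕ → OpenNormalSubgroup G) (hN : Antitone N)
  (d₁ : PadicFrd.Datum (CosetCat G) p₁) (d₂ : PadicFrd.Datum (CosetCat G₂) p₂)

include hG hG₂ hN in
/-- **[FrdII] Thm. 2.4 (ii), the pair "`G₁ ⥲ G₂`; `K̄₁^× ⥲ K̄₂^×`" of a GENERAL equivalence `Ψ`, read in the [AbsAnab] chart of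
the base fields `Kᵢ = ℚ̄_{pᵢ}^{Gᵢ}`.**  For fieldwise saturated `pᵢ`-adic Frobenioid data over the genuine §2 bases (open
`φᵢ : Πᵢ → G_{ℚ_{pᵢ}}`, `Gᵢ = Im φᵢ`), `E = Ψ^Base` with the row-L02 slot `ΨB`, a cofinal tower for `Π₁`, and the MLF
structures of `Kᵢ ⊇ ℚ_{pᵢ}` (`FiniteExtension.*`): there are `φ : Π₁ ≃ₜ* Π₂` over its descent `ψ : G₁ ≃ₜ* G₂`, the compatible
`ψ̄ : ℚ̄_{p₁}^× ⥲ ℚ̄_{p₂}^×` (`PadicFrobenioidPairIsoAlgClosure`), and their chart readings `α : Gal(K̄₁/K₁) ≃ₜ* Gal(K̄₂/K₂)` (`= ψ`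
through `galConjBase`), `ψ̄♮ : K̄₁^× ⥲ K̄₂^×` (`= ψ̄` through `closureEquiv`) such that: `ψ̄♮` is `α`-EQUIVARIANT
([AbsAnab] Prop. 1.2.1 (vi)), maps `𝒪^×_{K̄₁}` onto `𝒪^×_{K̄₂}` ((iii)), and equals THE units transport of (vi)/(vii) (row L02,
`unitsTransport_holds`) or its pointwise inverse; and the `K̄^×`-component is RIGID: any `ψ̄'` compatible with the same `φ`
is `ψ̄` or `ψ̄⁻¹`.  The one remaining bit (uniformiser ↦ uniformiser vs. its inverse) is exactly the orientation that [FrdI]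
Cor. 4.11 ("`Ψ` preserves `O^▷(−)`") supplies in print. [cite: MochizukiFrdII2008, Thm 2.4 (ii) p.21] -/
theorem exists_pairIso_absAnabChart
    (hd₁ : d₁.base = CosetCat.push φ₁ hφ₁.isOpenMap ⋙ CosetCat.toConnected (isTempered_galFbar ℚ_[p₁]) ⋙
      galoisPadicFields p₁)
    (hd₂ : d₂.base = CosetCat.push φ₂ hφ₂.isOpenMap ⋙ CosetCat.toConnected (isTempered_galFbar ℚ_[p₂]) ⋙
      galoisPadicFields p₂)
    (hfs₁ : d₁.IsFieldwiseSaturated) (hfs₂ : d₂.IsFieldwiseSaturated)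
    (E : CosetCat G ≌ CosetCat G₂) (ΨB : d₁.B ≅ E.functor.op ⋙ d₂.B)
    (hNb : ∀ U ∈ nhds (1 : G), ∃ k, (N k : Set G) ⊆ U) :
    haveI : IsNonarchimedeanLocalField ℚ_[p₁] := Padic.isNonarchimedeanLocalField_holds p₁
    haveI : IsNonarchimedeanLocalField ℚ_[p₂] := Padic.isNonarchimedeanLocalField_holds p₂
    haveI := PadicFrd.RelGal.finiteDimensional_baseFld p₁ φ₁ hφ₁
    haveI := PadicFrd.RelGal.finiteDimensional_baseFld p₂ φ₂ hφ₂
    letI := FiniteExtension.valuativeRel ℚ_[p₁] (PadicFrd.RelGal.baseFld p₁ φ₁ hφ₁)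
    letI := FiniteExtension.topologicalSpace ℚ_[p₁] (PadicFrd.RelGal.baseFld p₁ φ₁ hφ₁)
    letI := FiniteExtension.valuativeRel ℚ_[p₂] (PadicFrd.RelGal.baseFld p₂ φ₂ hφ₂)
    letI := FiniteExtension.topologicalSpace ℚ_[p₂] (PadicFrd.RelGal.baseFld p₂ φ₂ hφ₂)
    haveI := FiniteExtension.isNonarchimedeanLocalField ℚ_[p₁] (PadicFrd.RelGal.baseFld p₁ φ₁ hφ₁)
    haveI := FiniteExtension.isNonarchimedeanLocalField ℚ_[p₂] (PadicFrd.RelGal.baseFld p₂ φ₂ hφ₂)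
    ∃ (φ : G ≃ₜ* G₂) (ψ : φ₁.range ≃ₜ* φ₂.range) (ψbar : (Fbar ℚ_[p₁])ˣ ≃* (Fbar ℚ_[p₂])ˣ)
      (α : absoluteGaloisGroup (PadicFrd.RelGal.baseFld p₁ φ₁ hφ₁) ≃ₜ* absoluteGaloisGroup (PadicFrd.RelGal.baseFld p₂ φ₂ hφ₂))
      (ψn : (AlgebraicClosure (PadicFrd.RelGal.baseFld p₁ φ₁ hφ₁))ˣ ≃* (AlgebraicClosure (PadicFrd.RelGal.baseFld p₂ φ₂ hφ₂))ˣ),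
      φ₁.ker.map φ.toMulEquiv.toMonoidHom = φ₂.ker ∧
      (∀ g : G, (ψ ⟨φ₁ g, ⟨g, rfl⟩⟩ : GalFbar ℚ_[p₂]) = φ₂ (φ g)) ∧
      (∀ (σ : φ₁.range) (u : (Fbar ℚ_[p₁])ˣ),
        ψbar (Units.map ((σ : GalFbar ℚ_[p₁]) : Fbar ℚ_[p₁] →* Fbar ℚ_[p₁]) u) =
          Units.map (((ψ σ : φ₂.range) : GalFbar ℚ_[p₂]) : Fbar ℚ_[p₂] →* Fbar ℚ_[p₂]) (ψbar u)) ∧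
      (∀ ψbar' : (Fbar ℚ_[p₁])ˣ ≃* (Fbar ℚ_[p₂])ˣ,
        (∀ (g : G) (u : (Fbar ℚ_[p₁])ˣ),
          ψbar' (Units.map ((φ₁ g : GalFbar ℚ_[p₁]) : Fbar ℚ_[p₁] →* Fbar ℚ_[p₁]) u) =
            Units.map ((φ₂ (φ g) : GalFbar ℚ_[p₂]) : Fbar ℚ_[p₂] →* Fbar ℚ_[p₂]) (ψbar' u)) →
        ψbar' = ψbar ∨ ∀ u, ψbar' u = (ψbar u)⁻¹) ∧
      (∀ τ : absoluteGaloisGroup (PadicFrd.RelGal.baseFld p₁ φ₁ hφ₁),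
        ((PadicFrd.RelGal.galConjBase p₂ φ₂ hφ₂ (α τ) : ↥(PadicFrd.RelGal.baseFld p₂ φ₂ hφ₂).fixingSubgroup) :
            GalFbar ℚ_[p₂]) =
          (ψ ⟨(PadicFrd.RelGal.galConjBase p₁ φ₁ hφ₁ τ : ↥(PadicFrd.RelGal.baseFld p₁ φ₁ hφ₁).fixingSubgroup),
            MonoidHom.mem_range.mpr ((PadicFrd.RelGal.mem_fixingSubgroup_baseFld_iff p₁ φ₁ hφ₁ _).mp
              (PadicFrd.RelGal.galConjBase p₁ φ₁ hφ₁ τ).2)⟩ : GalFbar ℚ_[p₂])) ∧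
      (∀ y : (AlgebraicClosure (PadicFrd.RelGal.baseFld p₁ φ₁ hφ₁))ˣ,
        ((ψn y : (AlgebraicClosure (PadicFrd.RelGal.baseFld p₂ φ₂ hφ₂))ˣ) :
            AlgebraicClosure (PadicFrd.RelGal.baseFld p₂ φ₂ hφ₂)) =
          (PadicFrd.RelGal.closureEquiv p₂ φ₂ hφ₂).symm
            ((ψbar (Units.map ((PadicFrd.RelGal.closureEquiv p₁ φ₁ hφ₁ :
              AlgebraicClosure (PadicFrd.RelGal.baseFld p₁ φ₁ hφ₁) ≃ₐ[PadicFrd.RelGal.baseFld p₁ φ₁ hφ₁] Fbar ℚ_[p₁]) :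
                AlgebraicClosure (PadicFrd.RelGal.baseFld p₁ φ₁ hφ₁) →* Fbar ℚ_[p₁]) y) : (Fbar ℚ_[p₂])ˣ) :
              Fbar ℚ_[p₂])) ∧
      Prop121vii.IsAlphaEquivariant α ψn ∧ Prop121vii.PreservesAbsUnits ψn ∧
      ∃ ψ₀ : (AlgebraicClosure (PadicFrd.RelGal.baseFld p₁ φ₁ hφ₁))ˣ ≃* (AlgebraicClosure (PadicFrd.RelGal.baseFld p₂ φ₂ hφ₂))ˣ,
        (Prop121vii.IsAlphaEquivariant α ψ₀ ∧ Prop121vii.PreservesAbsUnits ψ₀ ∧ Prop121vii.PreservesUniformizers ψ₀) ∧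
        (ψn = ψ₀ ∨ ∀ x, ψn x = (ψ₀ x)⁻¹) := by
  haveI : IsNonarchimedeanLocalField ℚ_[p₁] := Padic.isNonarchimedeanLocalField_holds p₁
  haveI : IsNonarchimedeanLocalField ℚ_[p₂] := Padic.isNonarchimedeanLocalField_holds p₂
  haveI := PadicFrd.RelGal.finiteDimensional_baseFld p₁ φ₁ hφ₁
  haveI := PadicFrd.RelGal.finiteDimensional_baseFld p₂ φ₂ hφ₂
  letI := FiniteExtension.valuativeRel ℚ_[p₁] (PadicFrd.RelGal.baseFld p₁ φ₁ hφ₁)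
  letI := FiniteExtension.topologicalSpace ℚ_[p₁] (PadicFrd.RelGal.baseFld p₁ φ₁ hφ₁)
  letI := FiniteExtension.valuativeRel ℚ_[p₂] (PadicFrd.RelGal.baseFld p₂ φ₂ hφ₂)
  letI := FiniteExtension.topologicalSpace ℚ_[p₂] (PadicFrd.RelGal.baseFld p₂ φ₂ hφ₂)
  haveI := FiniteExtension.isNonarchimedeanLocalField ℚ_[p₁] (PadicFrd.RelGal.baseFld p₁ φ₁ hφ₁)
  haveI := FiniteExtension.isNonarchimedeanLocalField ℚ_[p₂] (PadicFrd.RelGal.baseFld p₂ φ₂ hφ₂)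
  haveI : CharZero (PadicFrd.RelGal.baseFld p₁ φ₁ hφ₁) :=
    charZero_of_injective_algebraMap (algebraMap ℚ_[p₁] (PadicFrd.RelGal.baseFld p₁ φ₁ hφ₁)).injective
  haveI : CharZero (PadicFrd.RelGal.baseFld p₂ φ₂ hφ₂) :=
    charZero_of_injective_algebraMap (algebraMap ℚ_[p₂] (PadicFrd.RelGal.baseFld p₂ φ₂ hφ₂)).injective
  obtain ⟨φ, ψ, ψbar, hker, hψ, hψbar, hσ⟩ :=
    exists_pairIso_fbarUnits hG hG₂ φ₁ hφ₁ φ₂ hφ₂ N hN d₁ d₂ hd₁ hd₂ hfs₁ hfs₂ E ΨB hNb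
  obtain ⟨α, ψn, hα, hψn, heq⟩ := exists_isAlphaEquivariant_of_compatible φ₁ hφ₁ φ₂ hφ₂ ψ ψbar hσ
  obtain ⟨hu, ψ₀, hψ₀, halt⟩ := preservesAbsUnits_of_isAlphaEquivariant heq
  refine ⟨φ, ψ, ψbar, α, ψn, hker, hψ, hσ, fun ψbar' h' => ?_, hα, hψn, heq, hu, ψ₀, hψ₀, halt⟩
  exact fbarUnitsEquiv_eq_or_eq_inv_of_equivariant φ₁ φ₂ hφ₂ φ.surjective ψbar ψbar' hψbar h'

end Assembled


end BaseGaloisSystem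

end Literature.AlgebraicGeometry.Frobenioids

end
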